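import Summits.CriticalPhenomena.PercolationContinuityZ3.Theorems.PercNearOneGluingNoHeavyLowerTailUniformLevelCounting
import Summits.CriticalPhenomena.PercolationContinuityZ3.Theorems.AdditiveGluing.Negative.CertSearchH

/-!
# `NoHeavyLowerTail` (crux stmt-CriticalPhenomena-4575 ≡ KN Conjecture 3), certificate programme:
# a certified LEVEL-COUNT checker for additive gluing / Kozma–Nitzan Conjecture 1 at EVERY
# uniform density — the checker and the soundness of its data

The certificates `additiveGluing_half_le_*` / `knConj1_half_le_*` (`Theorems/AdditiveGluing/Negative/`)
sit at the single density `1/2`.  The bridge `PercNearOneGluingNoHeavyLowerTailUniformLevelCounting.lean`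
(`P_p(D) = Σ_k #_k(D) p^k (1 − p)^{m−k}`, `#_k(D) = #{S ⊆ E : |S| = k, S ∈ D}`, `m = |E|`) turns LEVEL-WISE
count inequalities into inequalities valid for every `p ∈ [0, 1]` at once.  This file is the computable
side (Part 1, evaluated by `native_decide` in the companion file `…UniformCertLeFive.lean`) and the
soundness of its data (Part 2):

* `lvTabs` pairs the reach table of every sub-configuration of an edge list (`reachTable`,
  `CertChecker.lean`) with its level; `lvHist` is, per source `o`, the array histogram over
  (reach mask `T` of `o`, level `k`); `lvSum` reads the level vector `k ↦ #_k{ω : Q (mask of o)}` of a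
  mask test `Q` off it (over the occurring masks `occL` only); `convAt` is a convolution coefficient;
  `lvGraph n es` checks, for all `o ≠ b` and every `A ∌ o`, `A ≠ ∅` (the other triples are trivial):
  (AG) `∃ a ∈ A, ∀ k ≤ m, #_k{o ↔ A, o ↮ b} + #_k{a ↔ b} ≤ C(m, k)` and
  (KN) `∃ a ∈ A, ∀ s ≤ 2m, Σ_{i+j=s} #_i{o ↔ A} #_j{a ↔ b} ≤ Σ_{i+j=s} #_i{o ↔ b} C(m, j)`;
  `lvAll n` is the conjunction over all simple graphs on `Fin n`; `lvCnt` is the specification of the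
  level vectors (a `List.countP` over the sub-configurations).
* Soundness of the data: `getD_lvHist` (histogram entries are counts), `lvSum_spec` (fibre counting),
  `lvCnt_eq_card` (counts over `es.sublists'` = level counts `#{S ⊆ Eset es : |S| = k, S ∈ D}` of the
  matching event), `convAt_eq` (the convolution as a double indicator sum), `lvGraph_specAG` /
  `lvGraph_specKN` (what `lvGraph n es = true` says, in `lvCnt` form), and the level-count identities
  `levelCount_add_compl` (`#_k(D) + #_k(Dᶜ) = C(|E|, k)`, registered stub) and `levelCount_eq_zero`.

The measure-level consequences (every `p`) and the evaluations are in `…UniformCertLeFive.lean`.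
Nothing here asserts or refutes the crux; no proposition is defined (only computable functions).
-/

namespace Summit.CriticalPhenomena.PercolationContinuityZ3.Theorems

open MeasureTheory
open Literature.Probability.LatticeModels Literature.Probability.Percolation
open Summit.CriticalPhenomena.PercolationContinuityZ3.Theorems.AdditiveGluing.Negative.Cert

/-! ## Part 1. The level-count checker (computable; evaluated by `native_decide`) -/

section Checker

/-- The reach tables of all `2^m` sub-configurations of the edge list `es`, each paired with its
LEVEL (number of open edges), in `es.sublists'` order. -/
def lvTabs (n : ℕ) (es : List (Fin n × Fin n)) : List (List ℕ × ℕ) :=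
  es.sublists'.map fun ω => (reachTable n ω, ω.length)

/-- One histogram step for the source `o`: bump the entry `slot (m+1) T k = k + T (m+1)` of the
(reach mask `T` of `o`, level `k`) of the sub-configuration (out-of-range entries are ignored). -/
def lvStep (m o : ℕ) (h : Array ℕ) (t : List ℕ × ℕ) : Array ℕ :=
  if hi : slot (m + 1) (t.1.getD o 0) t.2 < h.size then
    h.set (slot (m + 1) (t.1.getD o 0) t.2) (h[slot (m + 1) (t.1.getD o 0) t.2] + 1) hi else h

/-- The level histogram of the source `o` (size `2^n (m+1)`):
entry `slot (m+1) T k` = `#{ω : reach mask of o = T, |ω| = k}`. -/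
def lvHist (n m : ℕ) (d : List (List ℕ × ℕ)) (o : ℕ) : Array ℕ :=
  d.foldl (lvStep m o) (Array.replicate (2 ^ n * (m + 1)) 0)

/-- The reach masks `T < 2^n` whose histogram row is not identically zero. -/
def occL (n m : ℕ) (h : Array ℕ) : List ℕ :=
  (List.range (2 ^ n)).filter fun T =>
    (List.range (m + 1)).any fun k => (h[slot (m + 1) T k]?).getD 0 != 0

/-- The level vector (size `m+1`) of a test `Q` of the reach mask, read off the histogram `h` over
the occurring masks `occ`: entry `k` = `Σ_{T ∈ occ, Q T} h[slot (m+1) T k]` (= `#_k{ω : Q (mask)}`). -/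
def lvSum (m : ℕ) (h : Array ℕ) (occ : List ℕ) (Q : ℕ → Bool) : Array ℕ :=
  ((List.range (m + 1)).map fun k =>
    (occ.map fun T => if Q T then (h[slot (m + 1) T k]?).getD 0 else 0).sum).toArray

/-- Convolution coefficient `s` of two level vectors: `Σ_{i ≤ s} x_i y_{s-i}` (entries beyond the
sizes count as `0`). -/
def convAt (x y : Array ℕ) (s : ℕ) : ℕ :=
  ((List.range (s + 1)).map fun i => (x[i]?).getD 0 * (y[s - i]?).getD 0).sum

/-- THE PER-GRAPH CHECK (edge list `es` on `Fin n`, `m = |es|`).  For every source `o`, every vertex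
set `A` (mask `Am`) with `A ≠ ∅`, `o ∉ A`, and every `b ≠ o`:
(AG-level) `∃ a ∈ A, ∀ k ≤ m, #_k{o ↔ A, o ↮ b} + #_k{a ↔ b} ≤ C(m, k)`, and
(KN-level) `∃ a ∈ A, ∀ s ≤ 2m, Σ_{i+j=s} #_i{o ↔ A} #_j{a ↔ b} ≤ Σ_{i+j=s} #_i{o ↔ b} C(m, j)`
(`cl[a][b]` = level vector of `{a ↔ b}`, `kr[o][b]` = the right-hand convolution). -/
def lvGraph (n : ℕ) (es : List (Fin n × Fin n)) : Bool :=
  let m := es.length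
  let d := lvTabs n es
  let hs := (List.range n).map fun o => lvHist n m d o
  let os := hs.map fun h => occL n m h
  let cl := (List.range n).map fun a => (List.range n).map fun b =>
    lvSum m (hs.getD a #[]) (os.getD a []) fun T => T.testBit b
  let bin := ((List.range (m + 1)).map fun j => m.choose j).toArray
  let kr := cl.map fun row => row.map fun c =>
    ((List.range (2 * m + 1)).map fun s => convAt c bin s).toArray
  (List.range n).all fun o =>
    (List.range (2 ^ n)).all fun Am => Am == 0 || Am.testBit o ||
      (let α := lvSum m (hs.getD o #[]) (os.getD o []) fun T => T &&& Am != 0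
      (List.range n).all fun b => o == b ||
        (let u := lvSum m (hs.getD o #[]) (os.getD o []) fun T => T &&& Am != 0 && !T.testBit b
        ((List.range n).any fun a => Am.testBit a &&
          (List.range (m + 1)).all fun k =>
            decide ((u[k]?).getD 0 + (((cl.getD a []).getD b #[])[k]?).getD 0 ≤ m.choose k)) &&
        ((List.range n).any fun a => Am.testBit a &&
          (List.range (2 * m + 1)).all fun s =>
            decide (convAt α ((cl.getD a []).getD b #[]) s ≤ (((kr.getD o []).getD b #[])[s]?).getD 0))))

/-- THE CHECK over all simple graphs on the vertex set `Fin n` (all sub-lists of `allPairs n`). -/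
def lvAll (n : ℕ) : Bool := (allPairs n).sublists'.all (lvGraph n)

/-- Specification of the level vectors: the number of sub-configurations of `es` at level `k` whose
reach mask of `src` passes the test `Q`. -/
def lvCnt (n : ℕ) (es : List (Fin n × Fin n)) (src : ℕ) (Q : ℕ → Bool) (k : ℕ) : ℕ :=
  (lvTabs n es).countP fun t => Q (t.1.getD src 0) && t.2 == k

end Checker

/-! ## Part 2. Soundness of the data -/

/-- Lookup in an array tabulated over `List.range`. -/
theorem getD_toArray_map_range (f : ℕ → ℕ) {i N : ℕ} (hi : i < N) :
    ((((List.range N).map f).toArray)[i]?).getD 0 = f i := by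
  rw [List.getElem?_toArray, List.getElem?_map, List.getElem?_range hi]; rfl

/-- Levels of the sub-configurations are at most `m = |es|`. -/
theorem lvTabs_level_le {n : ℕ} (es : List (Fin n × Fin n)) :
    ∀ t ∈ lvTabs n es, t.2 ≤ es.length := by
  intro t ht
  obtain ⟨ω, hω, rfl⟩ := List.mem_map.1 ht
  exact (List.mem_sublists'.1 hω).length_le

/-- Reach masks of a source `o < n` are `< 2^n`. -/
theorem lvTabs_mask_lt {n : ℕ} (es : List (Fin n × Fin n)) (o : Fin n) :
    ∀ t ∈ lvTabs n es, t.1.getD o 0 < 2 ^ n := by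
  intro t ht
  obtain ⟨ω, _, rfl⟩ := List.mem_map.1 ht
  rw [reachTable_getD]
  exact Nat.lt_pow_two_of_testBit _ fun i hi => testBit_reachM_eq_false o.2 hi

/-- Entries of the level histogram: for `T < 2^n` and `k ≤ m`,
`hist[slot (m+1) T k] = #{t ∈ d : mask_o t = T, level t = k}` (all levels of `d` being `≤ m`). -/
theorem getD_lvHist (n m : ℕ) (d : List (List ℕ × ℕ)) (hd : ∀ t ∈ d, t.2 ≤ m) (o T k : ℕ)
    (hT : T < 2 ^ n) (hk : k ≤ m) :
    ((lvHist n m d o)[slot (m + 1) T k]?).getD 0 =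
      d.countP fun t => t.1.getD o 0 == T && t.2 == k := by
  have hi : slot (m + 1) T k < 2 ^ n * (m + 1) := by
    unfold slot
    calc k + T * (m + 1) < (m + 1) + T * (m + 1) := by omega
      _ = (T + 1) * (m + 1) := by ring
      _ ≤ 2 ^ n * (m + 1) := Nat.mul_le_mul_right _ hT
  unfold lvHist
  suffices h : ∀ l : List (List ℕ × ℕ), (∀ t ∈ l, t.2 ≤ m) → ∀ h₀ : Array ℕ, h₀.size = 2 ^ n * (m + 1) →
      ((l.foldl (lvStep m o) h₀)[slot (m + 1) T k]?).getD 0 =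
        (h₀[slot (m + 1) T k]?).getD 0 + l.countP (fun t => t.1.getD o 0 == T && t.2 == k) by
    rw [h d hd _ Array.size_replicate, Array.getElem?_replicate, if_pos hi, Option.getD_some,
      zero_add]
  intro l
  induction l with
  | nil => intro _ h₀ _; simp
  | cons t l ih =>
    intro hl h₀ hsz
    have hsz' : (lvStep m o h₀ t).size = 2 ^ n * (m + 1) := by
      unfold lvStep; split_ifs <;> simp [hsz]
    have htm : t.2 ≤ m := hl t List.mem_cons_self
    have key : ((lvStep m o h₀ t)[slot (m + 1) T k]?).getD 0 =
        (h₀[slot (m + 1) T k]?).getD 0 + if (t.1.getD o 0 == T && t.2 == k) = true then 1 else 0 := by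
      unfold lvStep
      by_cases hidx : slot (m + 1) (t.1.getD o 0) t.2 = slot (m + 1) T k
      · obtain ⟨h1, h2⟩ := slot_inj (Nat.lt_succ_of_le htm) (Nat.lt_succ_of_le hk) hidx
        subst h1 h2
        have hlt : slot (m + 1) (t.1.getD o 0) t.2 < h₀.size := by rw [hsz]; exact hi
        rw [dif_pos hlt, Array.getElem?_set_self hlt, Array.getElem?_eq_getElem hlt]
        simp
      · have hp : ¬((t.1.getD o 0 == T && t.2 == k) = true) := by
          intro h
          rw [Bool.and_eq_true, beq_iff_eq, beq_iff_eq] at h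
          exact hidx (by rw [h.1, h.2])
        rw [if_neg hp, add_zero]
        split_ifs with hlt
        · rw [Array.getElem?_set_ne hlt hidx]
        · rfl
    rw [List.foldl_cons, ih (fun x hx => hl x (List.mem_cons_of_mem _ hx)) _ hsz', key,
      List.countP_cons]
    omega

/-- Summing a histogram row entry over the OCCURRING masks is summing it over all masks `< 2^n`
(the dropped rows are identically zero). -/
theorem sum_occL_eq (n m : ℕ) (h : Array ℕ) (Q : ℕ → Bool) {k : ℕ} (hk : k ≤ m) :
    ((occL n m h).map fun T => if Q T then (h[slot (m + 1) T k]?).getD 0 else 0).sum =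
      ((List.range (2 ^ n)).map fun T => if Q T then (h[slot (m + 1) T k]?).getD 0 else 0).sum := by
  unfold occL
  generalize List.range (2 ^ n) = L
  induction L with
  | nil => rfl
  | cons T L ih =>
    rw [List.filter_cons]
    by_cases hT : ((List.range (m + 1)).any fun k => (h[slot (m + 1) T k]?).getD 0 != 0) = true
    · rw [if_pos hT, List.map_cons, List.map_cons, List.sum_cons, List.sum_cons, ih]
    · rw [if_neg hT, List.map_cons, List.sum_cons, ih]
      have h0 : (h[slot (m + 1) T k]?).getD 0 = 0 := by
        rw [Bool.not_eq_true, List.any_eq_false] at hT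
        have := hT k (List.mem_range.2 (Nat.lt_succ_of_le hk))
        simpa using this
      rw [h0, ite_self, zero_add]

/-- Fibre counting: a test `Q` of the mask summed against the `(T, k)`-counts is the count of
`{Q (mask), level = k}` (all masks of `d` being `< 2^n`). -/
theorem sum_range_ite_countP (N o k : ℕ) (Q : ℕ → Bool) : ∀ d : List (List ℕ × ℕ),
    (∀ t ∈ d, t.1.getD o 0 < N) →
    (∑ T ∈ Finset.range N, if Q T then d.countP (fun t => t.1.getD o 0 == T && t.2 == k) else 0) =
      d.countP fun t => Q (t.1.getD o 0) && t.2 == k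
  | [], _ => by simp
  | t :: d, hd => by
    simp only [List.countP_cons]
    rw [← sum_range_ite_countP N o k Q d fun x hx => hd x (List.mem_cons_of_mem _ hx)]
    have hsplit : ∀ T ∈ Finset.range N,
        (if Q T = true then d.countP (fun t => t.1.getD o 0 == T && t.2 == k) +
            (if (t.1.getD o 0 == T && t.2 == k) = true then 1 else 0) else 0) =
        (if Q T = true then d.countP (fun t => t.1.getD o 0 == T && t.2 == k) else 0) +
          (if t.1.getD o 0 = T then (if (Q T && t.2 == k) = true then 1 else 0) else 0) := by
      intro T _
      split_ifs <;> simp_all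
    rw [Finset.sum_congr rfl hsplit, Finset.sum_add_distrib, Finset.sum_ite_eq,
      if_pos (Finset.mem_range.2 (hd t List.mem_cons_self))]

/-- **The level vectors are the level counts**: for a source `o < n`, any mask test `Q` and
`k ≤ m = |es|`, entry `k` of `lvSum` (read off the histogram of `o` over its occurring masks) is
`lvCnt n es o Q k = #{ω ⊆ es : |ω| = k, Q (reach mask of o)}`. -/
theorem lvSum_spec {n : ℕ} (es : List (Fin n × Fin n)) (o : Fin n) (Q : ℕ → Bool) {k : ℕ}
    (hk : k ≤ es.length) :
    ((lvSum es.length (lvHist n es.length (lvTabs n es) o)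
        (occL n es.length (lvHist n es.length (lvTabs n es) o)) Q)[k]?).getD 0 = lvCnt n es o Q k := by
  unfold lvSum lvCnt
  rw [List.getElem?_toArray, List.getElem?_map, List.getElem?_range (Nat.lt_succ_of_le hk),
    Option.map_some, Option.getD_some, sum_occL_eq _ _ _ _ hk, sum_map_range_eq,
    ← sum_range_ite_countP (2 ^ n) o k Q _ (lvTabs_mask_lt es o)]
  exact Finset.sum_congr rfl fun T hT => by
    rw [getD_lvHist n es.length _ (lvTabs_level_le es) o T k (Finset.mem_range.1 hT) hk]

open Classical in
/-- **Counts over sub-lists are level counts over the powerset.** If the mask test `Q` of the source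
`src` agrees with the event `D` on every configuration, then
`lvCnt n es src Q k = #{S ⊆ Eset es : |S| = k, S ∈ D}` (edge lists with distinct unordered images). -/
theorem lvCnt_eq_card {n : ℕ} {es : List (Fin n × Fin n)} (hnd : (es.map mkE).Nodup) (src : Fin n)
    (Q : ℕ → Bool) (D : Set (Set (Sym2 (Fin n))))
    (hQ : ∀ ω : List (Fin n × Fin n), Q ((reachTable n ω).getD src 0) = true ↔
      (↑(Eset ω) : Set (Sym2 (Fin n))) ∈ D) (k : ℕ) :
    lvCnt n es src Q k =
      ((Eset es).powerset.filter fun S : Finset (Sym2 (Fin n)) => S.card = k ∧ (↑S : Set (Sym2 (Fin n))) ∈ D).card := by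
  have h0 := card_filter_powerset_Eset es hnd
    (fun S : Finset (Sym2 (Fin n)) => decide (S.card = k) && decide ((↑S : Set (Sym2 (Fin n))) ∈ D))
  have e1 : ((Eset es).powerset.filter fun S : Finset (Sym2 (Fin n)) =>
        (decide (S.card = k) && decide ((↑S : Set (Sym2 (Fin n))) ∈ D)) = true) =
      ((Eset es).powerset.filter fun S : Finset (Sym2 (Fin n)) => S.card = k ∧ (↑S : Set (Sym2 (Fin n))) ∈ D) :=
    Finset.filter_congr fun S _ => by simp only [Bool.and_eq_true, decide_eq_true_eq]
  rw [e1] at h0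
  rw [lvCnt, lvTabs, List.countP_map, h0]
  refine List.countP_congr fun ω hω => ?_
  have hndω : (ω.map mkE).Nodup := hnd.sublist ((List.mem_sublists'.1 hω).map mkE)
  simp only [Function.comp_apply, Bool.and_eq_true, beq_iff_eq, decide_eq_true_eq, hQ ω,
    length_eq_card_Eset hndω]
  exact and_comm

/-- The convolution coefficient as a double indicator sum over `range (m+1) × range (m+1)`
(both vectors of size `m + 1`). -/
theorem convAt_eq (x y : Array ℕ) {m : ℕ} (hx : x.size = m + 1) (hy : y.size = m + 1) (s : ℕ) :
    convAt x y s = ∑ i ∈ Finset.range (m + 1), ∑ j ∈ Finset.range (m + 1),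
      if i + j = s then (x[i]?).getD 0 * (y[j]?).getD 0 else 0 := by
  have hf : ∀ i, m + 1 ≤ i → (x[i]?).getD 0 = 0 := fun i hi => by
    rw [Array.getElem?_eq_none (by rw [hx]; exact hi)]; rfl
  have hg : ∀ j, m + 1 ≤ j → (y[j]?).getD 0 = 0 := fun j hj => by
    rw [Array.getElem?_eq_none (by rw [hy]; exact hj)]; rfl
  have inner : ∀ i ∈ Finset.range (m + 1),
      (∑ j ∈ Finset.range (m + 1), if i + j = s then (x[i]?).getD 0 * (y[j]?).getD 0 else 0) =
        if i ≤ s then (x[i]?).getD 0 * (y[s - i]?).getD 0 else 0 := by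
    intro i _
    by_cases his : i ≤ s
    · rw [if_pos his]
      have : ∀ j ∈ Finset.range (m + 1),
          (if i + j = s then (x[i]?).getD 0 * (y[j]?).getD 0 else 0) =
            if s - i = j then (x[i]?).getD 0 * (y[j]?).getD 0 else 0 := fun j _ => by
        split_ifs with h1 h2 <;> first | rfl | (exfalso; omega)
      rw [Finset.sum_congr rfl this, Finset.sum_ite_eq]
      split_ifs with hmem
      · rfl
      · rw [Finset.mem_range, not_lt] at hmem
        rw [hg _ hmem, mul_zero]
    · rw [if_neg his]
      exact Finset.sum_eq_zero fun j _ => if_neg (by omega)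
  unfold convAt
  rw [sum_map_range_eq, Finset.sum_congr rfl inner, ← Finset.sum_filter]
  symm
  apply Finset.sum_subset
  · intro i hi
    simp only [Finset.mem_filter, Finset.mem_range] at hi ⊢
    omega
  · intro i hi hni
    simp only [Finset.mem_filter, Finset.mem_range, not_and, not_le] at hi hni
    rw [hf i (by omega), zero_mul]

/-- Size of a level vector. -/
theorem size_lvSum (m : ℕ) (h : Array ℕ) (occ : List ℕ) (Q : ℕ → Bool) : (lvSum m h occ Q).size = m + 1 := by
  simp [lvSum]

/-- What `lvGraph n es = true` says, AG part: for `o ≠ b`, `A ≠ ∅` (mask `Am < 2^n`), `o ∉ A`, some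
relay `a ∈ A` has `#_k{o ↔ A, o ↮ b} + #_k{a ↔ b} ≤ C(m, k)` for every level `k ≤ m`. -/
theorem lvGraph_specAG {n : ℕ} {es : List (Fin n × Fin n)} (h : lvGraph n es = true) (o b : Fin n)
    (hob : o ≠ b) {Am : ℕ} (hAm : Am < 2 ^ n) (hAm0 : Am ≠ 0) (hAo : Am.testBit o = false) :
    ∃ a : Fin n, Am.testBit a = true ∧ ∀ k, k ≤ es.length →
      lvCnt n es o (fun T => T &&& Am != 0 && !T.testBit b) k + lvCnt n es a (fun T => T.testBit b) k ≤
        es.length.choose k := by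
  simp only [lvGraph, List.all_eq_true, List.mem_range, Bool.or_eq_true, beq_iff_eq] at h
  have h1 := ((h o o.2 Am hAm).resolve_left (not_or.2 ⟨hAm0, by rw [hAo]; exact Bool.false_ne_true⟩))
    b b.2
  have h2 := h1.resolve_left (fun e => hob (Fin.ext e))
  rw [Bool.and_eq_true] at h2
  obtain ⟨a, ha, hh⟩ := List.any_eq_true.1 h2.1
  rw [List.mem_range] at ha
  rw [Bool.and_eq_true, List.all_eq_true] at hh
  refine ⟨⟨a, ha⟩, hh.1, fun k hk => ?_⟩
  have hk' := hh.2 k (List.mem_range.2 (Nat.lt_succ_of_le hk))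
  simp only [List.map_map, Function.comp_def, getD_map_range _ _ o.2, getD_map_range _ _ ha,
    getD_map_range _ _ b.2, decide_eq_true_eq] at hk'
  rwa [lvSum_spec es o _ hk, lvSum_spec es ⟨a, ha⟩ _ hk] at hk'

/-- What `lvGraph n es = true` says, KN part: for `o ≠ b`, `A ≠ ∅`, `o ∉ A`, some relay `a ∈ A` has
`Σ_{i+j=s} #_i{o ↔ A} #_j{a ↔ b} ≤ Σ_{i+j=s} #_i{o ↔ b} C(m, j)` for every `s ≤ 2m`. -/
theorem lvGraph_specKN {n : ℕ} {es : List (Fin n × Fin n)} (h : lvGraph n es = true) (o b : Fin n)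
    (hob : o ≠ b) {Am : ℕ} (hAm : Am < 2 ^ n) (hAm0 : Am ≠ 0) (hAo : Am.testBit o = false) :
    ∃ a : Fin n, Am.testBit a = true ∧ ∀ s, s < 2 * es.length + 1 →
      (∑ i ∈ Finset.range (es.length + 1), ∑ j ∈ Finset.range (es.length + 1),
        if i + j = s then lvCnt n es o (fun T => T &&& Am != 0) i * lvCnt n es a (fun T => T.testBit b) j
        else 0) ≤
      ∑ i ∈ Finset.range (es.length + 1), ∑ j ∈ Finset.range (es.length + 1),
        if i + j = s then lvCnt n es o (fun T => T.testBit b) i * es.length.choose j else 0 := by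
  simp only [lvGraph, List.all_eq_true, List.mem_range, Bool.or_eq_true, beq_iff_eq] at h
  have h1 := ((h o o.2 Am hAm).resolve_left (not_or.2 ⟨hAm0, by rw [hAo]; exact Bool.false_ne_true⟩))
    b b.2
  have h2 := h1.resolve_left (fun e => hob (Fin.ext e))
  rw [Bool.and_eq_true] at h2
  obtain ⟨a, ha, hh⟩ := List.any_eq_true.1 h2.2
  rw [List.mem_range] at ha
  rw [Bool.and_eq_true, List.all_eq_true] at hh
  refine ⟨⟨a, ha⟩, hh.1, fun s hs => ?_⟩
  have hs' := hh.2 s (List.mem_range.2 hs)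
  simp only [List.map_map, Function.comp_def, getD_map_range _ _ o.2, getD_map_range _ _ ha,
    getD_map_range _ _ b.2, decide_eq_true_eq, List.getElem?_toArray, List.getElem?_map,
    List.getElem?_range hs, Option.map_some, Option.getD_some] at hs'
  rw [convAt_eq _ _ (size_lvSum _ _ _ _) (size_lvSum _ _ _ _),
    convAt_eq _ _ (size_lvSum _ _ _ _) (by simp)] at hs'
  have eb : ∀ j ∈ Finset.range (es.length + 1),
      ((((List.range (es.length + 1)).map fun j => es.length.choose j).toArray)[j]?).getD 0 =
        es.length.choose j := fun j hj => getD_toArray_map_range _ (Finset.mem_range.1 hj)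
  calc _ = _ := by
        refine Finset.sum_congr rfl fun i hi => Finset.sum_congr rfl fun j hj => ?_
        rw [lvSum_spec es o _ (Nat.le_of_lt_succ (Finset.mem_range.1 hi)),
          lvSum_spec es ⟨a, ha⟩ _ (Nat.le_of_lt_succ (Finset.mem_range.1 hj))]
    _ ≤ _ := hs'
    _ = _ := by
        refine Finset.sum_congr rfl fun i hi => Finset.sum_congr rfl fun j hj => ?_
        rw [lvSum_spec es o _ (Nat.le_of_lt_succ (Finset.mem_range.1 hi)), eb j hj]

/-! ### Level-count identities -/

open Classical in
/-- At each level the counts of an event `D` and of its complement `D'` add up to `C(|E|, k)`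
(`D'` is any event with the membership of `Dᶜ`, to keep the statement instance-free). [folklore] -/
theorem levelCount_add_compl : ∀ {ι : Type} [Fintype ι] [DecidableEq ι] (E : Finset ι) (D D' : Set (Set ι)), (∀ S : Set ι, S ∈ D' ↔ S ∉ D) → ∀ k : ℕ, (E.powerset.filter fun S : Finset ι => S.card = k ∧ (↑S : Set ι) ∈ D).card + (E.powerset.filter fun S : Finset ι => S.card = k ∧ (↑S : Set ι) ∈ D').card = E.card.choose k := by
  intro ι _ _ E D D' hD' k
  rw [← Finset.card_powersetCard k E, Finset.powersetCard_eq_filter, ← Finset.card_filter_add_card_filter_not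
    (s := E.powerset.filter fun S : Finset ι => S.card = k) (fun S : Finset ι => (↑S : Set ι) ∈ D)]
  simp only [Finset.filter_filter, hD']

open Classical in
/-- No sub-configuration of `E` has more than `|E|` edges. [folklore] -/
theorem levelCount_eq_zero {ι : Type} [Fintype ι] [DecidableEq ι] (E : Finset ι) (D : Set (Set ι)) {k : ℕ}
    (hk : E.card < k) : (E.powerset.filter fun S : Finset ι => S.card = k ∧ (↑S : Set ι) ∈ D).card = 0 := by
  rw [Finset.card_eq_zero, Finset.filter_eq_empty_iff]
  intro S hS hSk
  have := Finset.card_le_card (Finset.mem_powerset.1 hS)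
  omega

end Summit.CriticalPhenomena.PercolationContinuityZ3.Theorems
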